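import Mathlib.Topology.Instances.NNReal.Lemmas
import Mathlib.Topology.UniformSpace.LocallyUniformConvergence
import Mathlib.Topology.UniformSpace.UniformApproximation
import Mathlib.Topology.MetricSpace.Pseudo.Lemmas
import Mathlib.Topology.Sequences
import Mathlib.Analysis.SpecificLimits.Basic
import HarnessLib

/-!
# Equicontinuous driving functions have locally uniformly convergent subsequences

Topic `Literature/Probability/RandomPlanarGeometry` (family `crit-ising`); theorems only, no
definition and no named fact. Elementary analysis (Arzelà–Ascoli on `[0, ∞)` by the diagonal
argument).

A. Kemppainen, S. Smirnov, *Random curves, scaling limits and Loewner evolutions*, Ann. Probab.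
45 (2017), App. A, Lemma A.7 (arXiv:1212.6215, Lemma 5.7), hypothesis (a) and its use: "If
`(W_n)` is equicontinuous … then [along a subsequence chosen by the Arzelà–Ascoli theorem] `W_n`
converges to some continuous `W`" — the step producing the locally uniformly convergent driving
functions fed to the main lemma (`exists_capacity_parametrisation_of_limit_of_tipModulus`,
`LoewnerCurveLimit.lean`) from the Hölder/equicontinuity event `E_3` of KS §3.5 (Prop. 3.8).

* `abs_le_of_equicontinuous` — equicontinuity on `[0, T]` uniformly in `n` and `W_n(0) = 0` give
  a uniform bound `|W_n(t)| ≤ B(T)` (chaining in steps of `δ/2`);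
* **`exists_subseq_tendstoLocallyUniformly_of_equicontinuous`** — a sequence of continuous
  `W_n : [0, ∞) → ℝ` with `W_n(0) = 0`, uniformly equicontinuous on every `[0, T]`, has a
  subsequence converging locally uniformly to a continuous `W` with `W(0) = 0` (diagonal
  subsequence converging at the nonnegative rationals — Tychonoff and sequential compactness in
  `ℕ → ℝ` — then uniformly Cauchy on each `[0, T]` by equicontinuity and a finite `δ`-net).

## References

* A. Kemppainen, S. Smirnov, Ann. Probab. 45 (2017), App. A Lemma A.7 (arXiv Lemma 5.7).
  [KemppainenSmirnov2017]
* W. Rudin, *Principles of Mathematical Analysis*, 3rd ed., Thm. 7.23 and 7.25 (Arzelà–Ascoli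
  by the diagonal process). [folklore]
-/

noncomputable section

open Set Filter Topology Metric

open scoped NNReal

namespace Literature.Probability.RandomPlanarGeometry

/-- **Uniform bound from equicontinuity and `W_n(0) = 0`**: if `|W_n(s) - W_n(t)| < 1` whenever
`s, t ≤ T`, `|s - t| < δ`, uniformly in `n`, then `|W_n(t)| ≤ k` whenever `t ≤ T` and
`t ≤ k δ/2` (chaining from `0` in steps of `δ/2`). [folklore] -/
theorem abs_le_of_equicontinuous {Wn : ℕ → ℝ≥0 → ℝ} (hW0 : ∀ n, Wn n 0 = 0) {T : ℝ≥0} {δ : ℝ}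
    (hδ : 0 < δ)
    (h : ∀ n, ∀ s t : ℝ≥0, s ≤ T → t ≤ T → dist s t < δ → dist (Wn n s) (Wn n t) < 1)
    (k : ℕ) (n : ℕ) (t : ℝ≥0) (ht : t ≤ T) (htk : (t : ℝ) ≤ k * (δ / 2)) : |Wn n t| ≤ k := by
  induction k generalizing t with
  | zero =>
    have ht0 : t = 0 := by
      apply le_antisymm _ bot_le
      exact_mod_cast (by simpa using htk : (t : ℝ) ≤ 0)
    rw [ht0, hW0 n, abs_zero]; simp
  | succ k ih =>
    -- step back by `δ/2` (truncated at `0`)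
    set d : ℝ≥0 := ⟨δ / 2, by positivity⟩ with hd
    set s : ℝ≥0 := t - d with hs
    have hs_le_t : s ≤ t := tsub_le_self
    have hsT : s ≤ T := hs_le_t.trans ht
    have hscoe : (s : ℝ) = max ((t : ℝ) - δ / 2) 0 := by
      rw [hs, NNReal.coe_sub_def]; rfl
    have hsk : (s : ℝ) ≤ k * (δ / 2) := by
      rw [hscoe]
      refine max_le ?_ (by positivity)
      have : ((k + 1 : ℕ) : ℝ) * (δ / 2) = k * (δ / 2) + δ / 2 := by push_cast; ring
      linarith
    have hdist : dist s t < δ := by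
      rw [NNReal.dist_eq, abs_sub_comm,
        abs_of_nonneg (sub_nonneg.2 (NNReal.coe_le_coe.2 hs_le_t))]
      have : (t : ℝ) - δ / 2 ≤ s := by rw [hscoe]; exact le_max_left _ _
      linarith
    have h1 := ih s hsT hsk
    have h2 := h n s t hsT ht hdist
    rw [Real.dist_eq] at h2
    have h3 : |Wn n t| ≤ |Wn n s| + |Wn n s - Wn n t| := by
      have := abs_sub_abs_le_abs_sub (Wn n t) (Wn n s)
      rw [abs_sub_comm] at this
      linarith
    push_cast
    linarith

/-- **Arzelà–Ascoli for driving functions (Kemppainen–Smirnov's Lemma A.7 (a)).** Let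
`W_n : [0, ∞) → ℝ` be continuous with `W_n(0) = 0` and uniformly equicontinuous on every
`[0, T]` (for all `ε > 0` some `δ > 0` works for all `n` and all `s, t ≤ T`). Then a
subsequence converges locally uniformly on `[0, ∞)` to a continuous `W` with `W(0) = 0`.
[cite: KemppainenSmirnov2017, App. A Lemma A.7] -/
theorem exists_subseq_tendstoLocallyUniformly_of_equicontinuous {Wn : ℕ → ℝ≥0 → ℝ}
    (hWc : ∀ n, Continuous (Wn n)) (hW0 : ∀ n, Wn n 0 = 0)
    (heq : ∀ T : ℝ≥0, ∀ ε > 0, ∃ δ > 0, ∀ n, ∀ s t : ℝ≥0, s ≤ T → t ≤ T →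
      dist s t < δ → dist (Wn n s) (Wn n t) < ε) :
    ∃ φ : ℕ → ℕ, StrictMono φ ∧ ∃ W : ℝ≥0 → ℝ, Continuous W ∧ W 0 = 0 ∧
      TendstoLocallyUniformly (fun k ↦ Wn (φ k)) W atTop := by
  /- Step 1: uniform bounds on `[0, T]` -/
  have hbd : ∀ T : ℝ≥0, ∃ B : ℝ, ∀ n, ∀ t ≤ T, |Wn n t| ≤ B := by
    intro T
    obtain ⟨δ, hδ, hδ1⟩ := heq T 1 one_pos
    obtain ⟨k, hk⟩ : ∃ k : ℕ, (T : ℝ) ≤ k * (δ / 2) := by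
      obtain ⟨k, hk⟩ := exists_nat_ge ((T : ℝ) / (δ / 2))
      exact ⟨k, by rwa [div_le_iff₀ (by positivity)] at hk⟩
    exact ⟨k, fun n t ht ↦ abs_le_of_equicontinuous hW0 hδ hδ1 k n t ht
      ((NNReal.coe_le_coe.2 ht).trans hk)⟩
  /- Step 2: a countable dense set of sample points and the diagonal subsequence -/
  set d : ℕ → ℝ≥0 := fun k ↦ Real.toNNReal (((Encodable.decode (α := ℚ) k).getD 0 : ℚ) : ℝ)
    with hd
  have hdense : ∀ t : ℝ≥0, ∀ δ > 0, ∃ k, dist (d k) t < δ := by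
    intro t δ hδ
    obtain ⟨q, hq1, hq2⟩ := exists_rat_btwn (show (t : ℝ) < t + δ by linarith)
    refine ⟨Encodable.encode q, ?_⟩
    have hdk : d (Encodable.encode q) = Real.toNNReal (q : ℝ) := by
      simp [hd, Encodable.encodek]
    rw [hdk, NNReal.dist_eq, Real.coe_toNNReal _ (t.coe_nonneg.trans hq1.le),
      abs_of_nonneg (by linarith)]
    linarith
  choose B hB using hbd
  set x : ℕ → (ℕ → ℝ) := fun n k ↦ Wn n (d k) with hx
  have hS : IsCompact (Set.pi univ fun k : ℕ ↦ Icc (-B (d k)) (B (d k))) :=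
    isCompact_univ_pi fun k ↦ isCompact_Icc
  have hxS : ∀ n, x n ∈ Set.pi univ fun k : ℕ ↦ Icc (-B (d k)) (B (d k)) := fun n k _ ↦
    abs_le.1 (hB (d k) n (d k) le_rfl)
  obtain ⟨a, -, φ, hφ, hlim⟩ := hS.tendsto_subseq hxS
  have hpt : ∀ k, Tendsto (fun n ↦ Wn (φ n) (d k)) atTop (𝓝 (a k)) := fun k ↦ by
    have := tendsto_pi_nhds.1 hlim k
    exact this
  /- Step 3: uniformly Cauchy on every `[0, T]` -/
  have hCauchy : ∀ T : ℝ≥0, UniformCauchySeqOn (fun n ↦ Wn (φ n)) atTop (Icc 0 T) := by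
    intro T
    rw [Metric.uniformCauchySeqOn_iff]
    intro ε hε
    obtain ⟨δ, hδ, hδε⟩ := heq (T + 1) (ε / 3) (by positivity)
    set δ' : ℝ := min δ 1 with hδ'
    have hδ'0 : 0 < δ' := lt_min hδ one_pos
    -- a finite `δ'`-net of `[0, T]` among the sample points
    have hcover : Icc (0 : ℝ≥0) T ⊆ ⋃ k : ℕ, ball (d k) δ' := fun t _ ↦ by
      obtain ⟨k, hk⟩ := hdense t δ' hδ'0
      exact mem_iUnion.2 ⟨k, by rwa [mem_ball, dist_comm]⟩
    obtain ⟨J, hJ⟩ := isCompact_Icc.elim_finite_subcover (fun k : ℕ ↦ ball (d k) δ')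
      (fun _ ↦ isOpen_ball) hcover
    -- beyond `N`, the subsequence is `ε/3`-Cauchy at every net point
    have hnet : ∀ k, ∃ N, ∀ m ≥ N, ∀ n ≥ N, dist (Wn (φ m) (d k)) (Wn (φ n) (d k)) < ε / 3 := by
      intro k
      have hc := (hpt k).cauchySeq
      rw [Metric.cauchySeq_iff] at hc
      exact hc (ε / 3) (by positivity)
    choose N hN using hnet
    refine ⟨J.sup N, fun m hm n hn t ht ↦ ?_⟩
    obtain ⟨k, hkJ, hk⟩ := mem_iUnion₂.1 (hJ ht)
    rw [mem_ball] at hk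
    have hNk : N k ≤ J.sup N := Finset.le_sup hkJ
    have h1 := hN k m (hNk.trans hm) n (hNk.trans hn)
    -- `t` and `d k` are `δ`-close points of `[0, T + 1]`
    have htT : t ≤ T + 1 := ht.2.trans le_self_add
    have hdkT : d k ≤ T + 1 := by
      have h2 : dist t (d k) < 1 := hk.trans_le (min_le_right _ _)
      rw [NNReal.dist_eq, abs_lt] at h2
      have h3 : ((d k : ℝ)) < T + 1 := by
        have := NNReal.coe_le_coe.2 ht.2
        linarith
      exact_mod_cast h3.le
    have hdist : dist t (d k) < δ := hk.trans_le (min_le_left _ _)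
    have h2 := hδε (φ m) t (d k) htT hdkT hdist
    have h3 := hδε (φ n) t (d k) htT hdkT hdist
    calc dist (Wn (φ m) t) (Wn (φ n) t)
        ≤ dist (Wn (φ m) t) (Wn (φ m) (d k)) + dist (Wn (φ m) (d k)) (Wn (φ n) (d k)) +
            dist (Wn (φ n) (d k)) (Wn (φ n) t) := dist_triangle4 _ _ _ _
      _ < ε / 3 + ε / 3 + ε / 3 := by
          gcongr
          rwa [dist_comm]
      _ = ε := by ring
  /- Step 4: the limit and the locally uniform convergence -/
  have hptC : ∀ t : ℝ≥0, CauchySeq fun n ↦ Wn (φ n) t := by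
    intro t
    rw [Metric.cauchySeq_iff]
    intro ε hε
    obtain ⟨N, hN⟩ := (Metric.uniformCauchySeqOn_iff.1 (hCauchy t)) ε hε
    exact ⟨N, fun m hm n hn ↦ hN m hm n hn t ⟨bot_le, le_rfl⟩⟩
  set W : ℝ≥0 → ℝ := fun t ↦ limUnder atTop fun n ↦ Wn (φ n) t with hWdef
  have hWt : ∀ t, Tendsto (fun n ↦ Wn (φ n) t) atTop (𝓝 (W t)) := fun t ↦
    tendsto_nhds_limUnder (cauchySeq_tendsto_of_complete (hptC t))
  have hunif : ∀ T : ℝ≥0, TendstoUniformlyOn (fun n ↦ Wn (φ n)) W atTop (Icc 0 T) := fun T ↦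
    (hCauchy T).tendstoUniformlyOn_of_tendsto fun t _ ↦ hWt t
  have hloc : TendstoLocallyUniformly (fun n ↦ Wn (φ n)) W atTop := by
    rw [← tendstoLocallyUniformlyOn_univ,
      tendstoLocallyUniformlyOn_iff_forall_isCompact isOpen_univ]
    intro K _ hK
    obtain ⟨T, hT⟩ := hK.isBounded.bddAbove
    exact (hunif T).mono fun t ht ↦ ⟨bot_le, hT ht⟩
  have hWcont : Continuous W :=
    hloc.continuous (Eventually.of_forall fun n ↦ hWc (φ n)).frequently
  have hW0' : W 0 = 0 := by
    have h := hWt 0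
    simp only [hW0] at h
    exact (tendsto_nhds_unique h tendsto_const_nhds)
  exact ⟨φ, hφ, W, hWcont, hW0', hloc⟩

end Literature.Probability.RandomPlanarGeometry
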